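import Literature.NumberTheory.Sieve.PairLinearFormDivisorSums
import HarnessLib

/-!
# Short-interval sums of divisor functions along one or two linear forms

Topic `Literature/NumberTheory/Sieve`.  Everything here is PROVED; no definition is introduced.
For integers `q ≥ 1`, `a`, and naturals `2 ≤ x`, `y ≤ x`, writing `τ(v⁺)` for the number of
divisors of the natural number `max(v, 0)` (so that `τ(v⁺) = 0` for `v ≤ 0`):

* `LinearPairShells.sum_Ioc_pow_card_divisors_linear_le` —
  `∑_{x − y < n ≤ x} τ((qn + a)⁺)^s ≤ C (y (log x)^c + x^{3/4})`, `C, c` depending on `q, a, s`;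
* `LinearPairShells.sum_Ioc_card_divisors_mul_le` — for two forms,
  `∑_{x − y < n ≤ x} τ((q₀n + a₀)⁺) τ((q₁n + a₁)⁺) ≤ C (y (log x)^c + x^{3/4})`.

These are the crude short-interval divisor bounds used to discard boundary layers `n ∈ (x − y, x]`
in divisor-sum / dispersion arguments for pairs of linear forms.  The proof is the standard one:
`uv ≤ u² + v²`, Landreau's inequality with cutoff `X^{1/4}`, `X = ((q + |a| + 1) x)²`
(`PairDivisorSums.card_divisors_pow_le_sum_Icc`: `τ(N)^s ≤ C ∑_{e ∣ N, e ≤ X^{1/4}} τ(e)^M` for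
`N ≤ X`), the count of multiples of `e` among the `qn + a` (`≤ qy/e + 1`), and the divisor power
moments `∑_{e ≤ z} τ(e)^M / e ≪ (log z)^{2^{M+1}}`, `∑_{e ≤ z} τ(e)^M ≪ z (log z)^{2^{M+1}}`.
The exponent `c` is not optimal (Shiu's theorem gives `c = 3` for `y ≥ x^ε`); only polynomial
growth in `log x` matters downstream.

## References

* P. Shiu, J. reine angew. Math. 313 (1980), 161–170, Theorem 1 (the sharp form). [folklore]
* T. Tao, J. Teräväinen, J. London Math. Soc. 106 (2022), Lemma 3.1 (Landreau's inequality).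
  [folklore]
-/

open Finset Real
open scoped ArithmeticFunction.sigma

namespace Literature.NumberTheory.Sieve

namespace LinearPairShells

/-! ### Small tools -/

/-- Powers of `log` are eventually below any power: for `c ∈ ℕ` and `δ > 0` there is `K > 0` with
`(log x)^c ≤ K x^δ` for all `x ≥ 1`. [folklore] -/
theorem exists_log_pow_le_mul_rpow (c : ℕ) {δ : ℝ} (hδ : 0 < δ) :
    ∃ K : ℝ, 0 < K ∧ ∀ x : ℝ, 1 ≤ x → Real.log x ^ c ≤ K * x ^ δ := by
  rcases Nat.eq_zero_or_pos c with rfl | hc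
  · refine ⟨1, one_pos, fun x hx => ?_⟩
    rw [pow_zero, one_mul]
    exact Real.one_le_rpow hx hδ.le
  · have hc' : (0 : ℝ) < c := by exact_mod_cast hc
    refine ⟨((c : ℝ) / δ) ^ c, by positivity, fun x hx => ?_⟩
    have hx0 : (0 : ℝ) ≤ x := by linarith
    have hε : 0 < δ / c := div_pos hδ hc'
    have h1 : Real.log x ≤ x ^ (δ / c) / (δ / c) := Real.log_le_rpow_div hx0 hε
    have h2 : 0 ≤ Real.log x := Real.log_nonneg hx
    calc Real.log x ^ c ≤ (x ^ (δ / c) / (δ / c)) ^ c := pow_le_pow_left₀ h2 h1 c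
      _ = ((c : ℝ) / δ) ^ c * (x ^ (δ / c)) ^ c := by
          rw [← mul_pow]
          congr 1
          field_simp
      _ = ((c : ℝ) / δ) ^ c * x ^ δ := by
          congr 1
          rw [← Real.rpow_natCast, ← Real.rpow_mul hx0]
          congr 1
          field_simp

/-- For `x ≥ 2` and `c₀ ≤ c`: `(log x)^{c₀} ≤ (1/log 2)^c (log x)^c`. [folklore] -/
theorem log_pow_le_of_le {c₀ c : ℕ} (h : c₀ ≤ c) {x : ℝ} (hx : 2 ≤ x) :
    Real.log x ^ c₀ ≤ (1 / Real.log 2) ^ c * Real.log x ^ c := by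
  have hlog2 : 0 < Real.log 2 := Real.log_pos one_lt_two
  have hlx : Real.log 2 ≤ Real.log x := Real.log_le_log two_pos hx
  have h1 : 1 ≤ Real.log x / Real.log 2 := by rwa [le_div_iff₀ hlog2, one_mul]
  have hl2 : Real.log 2 ≤ 1 := by
    have := Real.log_two_lt_d9; linarith
  calc Real.log x ^ c₀ ≤ (Real.log x / Real.log 2) ^ c₀ := by
        refine pow_le_pow_left₀ (hlog2.le.trans hlx) ?_ c₀
        rw [le_div_iff₀ hlog2]
        nlinarith [hlog2.le.trans hlx]
    _ ≤ (Real.log x / Real.log 2) ^ c := pow_le_pow_right₀ h1 h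
    _ = (1 / Real.log 2) ^ c * Real.log x ^ c := by rw [← mul_pow]; ring

/-- **Multiples of `e` among the values of a linear form on a segment**: for `q ≥ 1`, `e ≥ 1` and
`x₁ ≤ x₂`, `#{x₁ < n ≤ x₂ : e ∣ qn + a} ≤ q(x₂ − x₁)/e + 1` (the values `qn + a` are distinct and
their quotients by `e` lie in an integer interval of that length). [folklore] -/
theorem card_Ioc_filter_dvd_linear_le {q : ℤ} (hq : 0 < q) (a : ℤ) {e : ℕ} (he : 0 < e)
    {x₁ x₂ : ℕ} (hx : x₁ ≤ x₂) :
    (((Ioc x₁ x₂).filter fun n : ℕ => (e : ℤ) ∣ q * n + a).card : ℝ) ≤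
      (q : ℝ) * ((x₂ : ℝ) - x₁) / e + 1 := by
  set A : ℤ := q * x₁ + a with hA
  set B : ℤ := q * x₂ + a with hB
  have heZ : (0 : ℤ) < e := by exact_mod_cast he
  have hinj : ((Ioc x₁ x₂).filter fun n : ℕ => (e : ℤ) ∣ q * n + a).card ≤
      (Finset.Ioc (A / e) (B / e)).card := by
    refine Finset.card_le_card_of_injOn (fun n : ℕ => (q * n + a) / e) ?_ ?_
    · intro n hn
      rw [Finset.mem_coe, Finset.mem_filter, Finset.mem_Ioc] at hn
      obtain ⟨⟨hn1, hn2⟩, hdvd⟩ := hn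
      rw [Finset.mem_coe, Finset.mem_Ioc]
      have hmul : (e : ℤ) * ((q * n + a) / e) = q * n + a := Int.mul_ediv_cancel' hdvd
      constructor
      · have h1 : (e : ℤ) * (A / e) ≤ A := Int.mul_ediv_self_le heZ.ne'
        have h2 : A < q * n + a := by
          have : (x₁ : ℤ) < n := by exact_mod_cast hn1
          rw [hA]; nlinarith
        by_contra hcon
        push Not at hcon
        have h3 : (e : ℤ) * ((q * n + a) / e) ≤ (e : ℤ) * (A / e) :=
          mul_le_mul_of_nonneg_left hcon heZ.le
        omega
      · refine Int.ediv_le_ediv heZ ?_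
        have : (n : ℤ) ≤ x₂ := by exact_mod_cast hn2
        rw [hB]; nlinarith
    · intro n₁ hn₁ n₂ hn₂ heq
      rw [Finset.mem_coe, Finset.mem_filter] at hn₁ hn₂
      have h1 : (e : ℤ) * ((q * n₁ + a) / e) = q * n₁ + a := Int.mul_ediv_cancel' hn₁.2
      have h2 : (e : ℤ) * ((q * n₂ + a) / e) = q * n₂ + a := Int.mul_ediv_cancel' hn₂.2
      have heq' : (q * n₁ + a) / e = (q * n₂ + a) / e := heq
      have h3 : q * (n₁ : ℤ) = q * n₂ := by rw [heq'] at h1; linarith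
      have h4 : (n₁ : ℤ) = n₂ := mul_left_cancel₀ hq.ne' h3
      exact_mod_cast h4
  rw [Int.card_Ioc] at hinj
  have hcast : (((Ioc x₁ x₂).filter fun n : ℕ => (e : ℤ) ∣ q * n + a).card : ℝ) ≤
      (((B / e - A / e).toNat : ℕ) : ℝ) := by exact_mod_cast hinj
  refine hcast.trans ?_
  have heR : (0 : ℝ) < e := by exact_mod_cast he
  have hrhs : (0 : ℝ) ≤ (q : ℝ) * ((x₂ : ℝ) - x₁) / e := by
    have : (x₁ : ℝ) ≤ x₂ := by exact_mod_cast hx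
    have hq' : (0 : ℝ) ≤ q := by exact_mod_cast hq.le
    exact div_nonneg (mul_nonneg hq' (by linarith)) heR.le
  rcases le_or_gt (B / e - A / e) 0 with hle | hgt
  · rw [Int.toNat_of_nonpos hle]; push_cast; linarith
  · have hnn : (((B / e - A / e).toNat : ℕ) : ℝ) = ((B / e - A / e : ℤ) : ℝ) := by
      have h := Int.toNat_of_nonneg hgt.le
      exact_mod_cast h
    rw [hnn]
    have h1 : (e : ℤ) * (B / e) ≤ B := Int.mul_ediv_self_le heZ.ne'
    have h2 : A < (e : ℤ) * (A / e) + e := Int.lt_mul_ediv_self_add heZ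
    have h3 : (e : ℤ) * (B / e - A / e) < B - A + e := by linarith [mul_sub (e : ℤ) (B / e) (A / e)]
    have h4 : B - A = q * ((x₂ : ℤ) - x₁) := by rw [hA, hB]; ring
    rw [h4] at h3
    have h5 : ((e : ℝ)) * ((B / e - A / e : ℤ) : ℝ) < (q : ℝ) * ((x₂ : ℝ) - x₁) + e := by
      have := h3
      exact_mod_cast this
    rw [div_add_one heR.ne', le_div_iff₀ heR]
    linarith


/-! ### One linear form -/

/-- **Short-interval divisor power sums along a linear form.**  For `s ≥ 1`, `q ≥ 1` and `a ∈ ℤ`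
there are `C > 0` and `c` such that for all naturals `x ≥ 2` and `y ≤ x`:
`∑_{x − y < n ≤ x} τ((qn + a)⁺)^s ≤ C (y (log x)^c + x^{3/4})`, where `τ(v⁺)` is the number of
divisors of the natural number `v⁺ = max(v, 0)` (Mathlib: `Nat.divisors 0 = ∅`).  Landreau's
inequality with cutoff `√((q + |a| + 1) x)` and the count of multiples of `e` among the `qn + a`.
[folklore] -/
theorem sum_Ioc_pow_card_divisors_linear_le {s : ℕ} (hs : 1 ≤ s) {q : ℤ} (hq : 0 < q) (a : ℤ) :
    ∃ C : ℝ, 0 < C ∧ ∃ c : ℕ, ∀ x y : ℕ, 2 ≤ x → y ≤ x →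
      ∑ n ∈ Ioc (x - y) x, ((((q * n + a).toNat).divisors.card : ℕ) : ℝ) ^ s ≤
        C * ((y : ℝ) * Real.log x ^ c + (x : ℝ) ^ (3 / 4 : ℝ)) := by
  -- constants
  obtain ⟨C₂, hC₂, M, hL⟩ := PairDivisorSums.card_divisors_pow_le_sum_Icc
    (show (0 : ℝ) < 1 / 4 by norm_num) s
  obtain ⟨C₃, hC₃, hD⟩ := exists_sum_sigma_zero_pow_div_le_real M
  obtain ⟨C₄, hC₄, hE⟩ := exists_sum_sigma_zero_pow_le_real M
  obtain ⟨K₁, hK₁, hlogpow⟩ := exists_log_pow_le_mul_rpow (2 ^ (M + 1)) (show (0 : ℝ) < 1 / 4 by norm_num)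
  obtain ⟨K, hK⟩ : ∃ K : ℕ, K = q.toNat + a.natAbs + 1 := ⟨_, rfl⟩
  have hK1 : 1 ≤ K := by omega
  have hKq : (K : ℤ) = q + |a| + 1 := by
    rw [hK]; push_cast; rw [Int.toNat_of_nonneg hq.le]
  have hK2 : (2 : ℝ) ≤ K := by
    have : (2 : ℤ) ≤ K := by rw [hKq]; have := abs_nonneg a; omega
    exact_mod_cast this
  obtain ⟨κ₀, hκ₀⟩ : ∃ κ₀ : ℝ, κ₀ = Real.log K / Real.log 2 + 1 := ⟨_, rfl⟩
  have hlog2 : 0 < Real.log 2 := Real.log_pos one_lt_two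
  have hκ₀1 : 1 ≤ κ₀ := by
    rw [hκ₀]
    have : 0 ≤ Real.log K := Real.log_nonneg (by linarith)
    have : 0 ≤ Real.log K / Real.log 2 := div_nonneg this hlog2.le
    linarith
  obtain ⟨c, hc⟩ : ∃ c : ℕ, c = 2 ^ (M + 1) := ⟨_, rfl⟩
  refine ⟨C₂ * κ₀ ^ c * ((q : ℝ) * C₃ + C₄ * Real.sqrt K * K₁), ?_, c, ?_⟩
  · have hq' : (0 : ℝ) < q := by exact_mod_cast hq
    positivity
  intro x y hx hyx
  have hx0 : (0 : ℝ) < x := by exact_mod_cast (show 0 < x by omega)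
  have hx1 : (1 : ℝ) ≤ x := by exact_mod_cast (show 1 ≤ x by omega)
  have hx2 : (2 : ℝ) ≤ x := by exact_mod_cast hx
  have hq' : (0 : ℝ) < q := by exact_mod_cast hq
  have hK0 : (0 : ℝ) < K := by linarith
  -- the cutoff `z = √(K x) ≥ 2` and the Landreau parameter `Xr = (K x)²`
  set z : ℝ := Real.sqrt ((K : ℝ) * x) with hz
  have hKx4 : (4 : ℝ) ≤ (K : ℝ) * x := by nlinarith
  have hz2 : 2 ≤ z := by
    rw [hz, show (2 : ℝ) = Real.sqrt 4 by
      rw [show (4 : ℝ) = 2 ^ 2 by norm_num, Real.sqrt_sq (by norm_num)]]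
    exact Real.sqrt_le_sqrt hKx4
  have hz1 : 1 ≤ z := by linarith
  have hz0 : 0 < z := by linarith
  set Xr : ℝ := ((K : ℝ) * x) ^ 2 with hXr
  have hXrz : Xr ^ (1 / 4 : ℝ) = z := by
    rw [hXr, hz, Real.sqrt_eq_rpow, show ((K : ℝ) * x) ^ 2 = ((K : ℝ) * x) ^ ((2 : ℕ) : ℝ) from
      (Real.rpow_natCast _ 2).symm, ← Real.rpow_mul (by positivity)]
    norm_num
  -- logarithms: `log z ≤ log (K x) ≤ κ₀ log x`
  have hlogx : Real.log 2 ≤ Real.log x := Real.log_le_log two_pos hx2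
  have hlogx0 : 0 < Real.log x := hlog2.trans_le hlogx
  have hlogz0 : 0 ≤ Real.log z := Real.log_nonneg hz1
  have hlogz : Real.log z ≤ κ₀ * Real.log x := by
    have h1 : z ≤ (K : ℝ) * x := by
      rw [hz]; rw [Real.sqrt_le_left (by positivity)]; nlinarith
    have h2 : Real.log z ≤ Real.log K + Real.log x := by
      rw [← Real.log_mul hK0.ne' hx0.ne']; exact Real.log_le_log hz0 h1
    have h3 : Real.log K ≤ Real.log K / Real.log 2 * Real.log x := by
      rw [div_mul_eq_mul_div, le_div_iff₀ hlog2]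
      exact mul_le_mul_of_nonneg_left hlogx (Real.log_nonneg (by linarith))
    rw [hκ₀]; linarith
  have hlogzc : Real.log z ^ c ≤ κ₀ ^ c * Real.log x ^ c := by
    rw [← mul_pow]; exact pow_le_pow_left₀ hlogz0 hlogz c
  -- (1) pointwise Landreau bound
  have hpt : ∀ n ∈ Ioc (x - y) x, ((((q * n + a).toNat).divisors.card : ℕ) : ℝ) ^ s ≤
      C₂ * ∑ e ∈ Icc 1 ⌊z⌋₊, if (1 ≤ q * n + a ∧ (e : ℤ) ∣ q * n + a) then
        (((e.divisors.card : ℕ) : ℝ)) ^ M else 0 := by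
    intro n hn
    rw [Finset.mem_Ioc] at hn
    by_cases hN : 1 ≤ q * n + a
    · have hN0 : (q * n + a).toNat ≠ 0 := by omega
      have hNX : (((q * n + a).toNat : ℕ) : ℝ) ≤ Xr := by
        have h1 : (((q * n + a).toNat : ℕ) : ℤ) = q * n + a := Int.toNat_of_nonneg (by omega)
        have h2 : q * n + a ≤ (K : ℤ) * x := by
          rw [hKq]
          have hn' : (n : ℤ) ≤ x := by exact_mod_cast hn.2
          have ha : a ≤ |a| := le_abs_self a
          have hx' : (1 : ℤ) ≤ x := by exact_mod_cast (show 1 ≤ x by omega)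
          nlinarith [abs_nonneg a]
        have h3 : (((q * n + a).toNat : ℕ) : ℝ) ≤ (K : ℝ) * x := by
          have : (((q * n + a).toNat : ℕ) : ℤ) ≤ (K : ℤ) * x := h1 ▸ h2
          exact_mod_cast this
        refine h3.trans ?_
        rw [hXr]; nlinarith
      have h := hL Xr _ hN0 hNX
      rw [hXrz] at h
      refine h.trans (le_of_eq ?_)
      congr 1
      refine Finset.sum_congr rfl fun e _ => ?_
      have hdvd : (e ∣ (q * n + a).toNat) ↔ ((e : ℤ) ∣ q * n + a) := by
        rw [← Int.natCast_dvd_natCast, Int.toNat_of_nonneg (by omega)]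
      by_cases he : (e : ℤ) ∣ q * n + a
      · rw [if_pos (hdvd.2 he), if_pos ⟨hN, he⟩]
      · rw [if_neg (fun h' => he (hdvd.1 h')), if_neg (fun h' => he h'.2)]
    · have h0 : (q * n + a).toNat = 0 := by omega
      rw [h0, Nat.divisors_zero, Finset.card_empty, Nat.cast_zero, zero_pow (by omega)]
      refine mul_nonneg hC₂.le (Finset.sum_nonneg fun e _ => ?_)
      split_ifs <;> positivity
  -- (2) sum over `n` and swap
  have hswap : ∑ n ∈ Ioc (x - y) x, (C₂ * ∑ e ∈ Icc 1 ⌊z⌋₊,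
      if (1 ≤ q * n + a ∧ (e : ℤ) ∣ q * n + a) then (((e.divisors.card : ℕ) : ℝ)) ^ M else 0) =
      C₂ * ∑ e ∈ Icc 1 ⌊z⌋₊, (((e.divisors.card : ℕ) : ℝ)) ^ M *
        (((Ioc (x - y) x).filter fun n : ℕ => 1 ≤ q * n + a ∧ (e : ℤ) ∣ q * n + a).card : ℝ) := by
    rw [← Finset.mul_sum, Finset.sum_comm]
    congr 1
    refine Finset.sum_congr rfl fun e _ => ?_
    rw [← Finset.sum_filter, Finset.sum_const, nsmul_eq_mul, mul_comm]
  -- (3) the count of `n`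
  have hcount : ∀ e ∈ Icc 1 ⌊z⌋₊,
      (((Ioc (x - y) x).filter fun n : ℕ => 1 ≤ q * n + a ∧ (e : ℤ) ∣ q * n + a).card : ℝ) ≤
        (q : ℝ) * y / e + 1 := by
    intro e he
    rw [Finset.mem_Icc] at he
    have h1 : ((Ioc (x - y) x).filter fun n : ℕ => 1 ≤ q * n + a ∧ (e : ℤ) ∣ q * n + a).card ≤
        ((Ioc (x - y) x).filter fun n : ℕ => (e : ℤ) ∣ q * n + a).card := by
      refine Finset.card_le_card fun n hn => ?_
      rw [Finset.mem_filter] at hn ⊢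
      exact ⟨hn.1, hn.2.2⟩
    have h2 := card_Ioc_filter_dvd_linear_le hq a he.1 (Nat.sub_le x y)
    have h3 : ((x : ℝ)) - ((x - y : ℕ) : ℝ) = y := by
      rw [Nat.cast_sub hyx]; ring
    rw [h3] at h2
    exact le_trans (by exact_mod_cast h1) h2
  -- (4) the divisor power sums over `e ≤ z`
  have hDz : ∑ e ∈ Icc 1 ⌊z⌋₊, (((e.divisors.card : ℕ) : ℝ)) ^ M / e ≤ C₃ * (κ₀ ^ c * Real.log x ^ c) := by
    have h1 := hD z hz2
    calc ∑ e ∈ Icc 1 ⌊z⌋₊, (((e.divisors.card : ℕ) : ℝ)) ^ M / e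
        = ∑ n ∈ Icc 1 ⌊z⌋₊, (σ 0 n : ℝ) ^ M / n := by
          refine Finset.sum_congr rfl fun n _ => ?_
          rw [ArithmeticFunction.sigma_zero_apply]
      _ ≤ C₃ * Real.log z ^ 2 ^ (M + 1) := h1
      _ ≤ C₃ * (κ₀ ^ c * Real.log x ^ c) := by
          rw [← hc]; exact mul_le_mul_of_nonneg_left hlogzc hC₃.le
  have hEz : ∑ e ∈ Icc 1 ⌊z⌋₊, (((e.divisors.card : ℕ) : ℝ)) ^ M ≤ C₄ * z * (κ₀ ^ c * Real.log x ^ c) := by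
    have h1 := hE z hz2
    calc ∑ e ∈ Icc 1 ⌊z⌋₊, (((e.divisors.card : ℕ) : ℝ)) ^ M
        = ∑ n ∈ Icc 1 ⌊z⌋₊, (σ 0 n : ℝ) ^ M := by
          refine Finset.sum_congr rfl fun n _ => ?_
          rw [ArithmeticFunction.sigma_zero_apply]
      _ ≤ C₄ * z * Real.log z ^ 2 ^ (M + 1) := h1
      _ ≤ C₄ * z * (κ₀ ^ c * Real.log x ^ c) := by
          rw [← hc]; exact mul_le_mul_of_nonneg_left hlogzc (by positivity)
  -- (5) `z (log x)^c ≤ √K K₁ x^{3/4}`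
  have hzx : z * Real.log x ^ c ≤ Real.sqrt K * K₁ * (x : ℝ) ^ (3 / 4 : ℝ) := by
    have h1 : Real.log x ^ c ≤ K₁ * (x : ℝ) ^ (1 / 4 : ℝ) := by rw [hc]; exact hlogpow x hx1
    have h2 : z = Real.sqrt K * Real.sqrt x := by rw [hz, Real.sqrt_mul (Nat.cast_nonneg K)]
    have h3 : Real.sqrt (x : ℝ) * (x : ℝ) ^ (1 / 4 : ℝ) = (x : ℝ) ^ (3 / 4 : ℝ) := by
      rw [Real.sqrt_eq_rpow, ← Real.rpow_add hx0]; norm_num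
    calc z * Real.log x ^ c ≤ z * (K₁ * (x : ℝ) ^ (1 / 4 : ℝ)) :=
          mul_le_mul_of_nonneg_left h1 hz0.le
      _ = Real.sqrt K * K₁ * (Real.sqrt (x : ℝ) * (x : ℝ) ^ (1 / 4 : ℝ)) := by rw [h2]; ring
      _ = Real.sqrt K * K₁ * (x : ℝ) ^ (3 / 4 : ℝ) := by rw [h3]
  -- assembly
  have hy0 : (0 : ℝ) ≤ y := Nat.cast_nonneg y
  have hτ0 : ∀ e : ℕ, (0 : ℝ) ≤ (((e.divisors.card : ℕ) : ℝ)) ^ M := fun e => by positivity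
  calc ∑ n ∈ Ioc (x - y) x, ((((q * n + a).toNat).divisors.card : ℕ) : ℝ) ^ s
      ≤ ∑ n ∈ Ioc (x - y) x, (C₂ * ∑ e ∈ Icc 1 ⌊z⌋₊,
          if (1 ≤ q * n + a ∧ (e : ℤ) ∣ q * n + a) then (((e.divisors.card : ℕ) : ℝ)) ^ M else 0) :=
        Finset.sum_le_sum hpt
    _ = C₂ * ∑ e ∈ Icc 1 ⌊z⌋₊, (((e.divisors.card : ℕ) : ℝ)) ^ M *
        (((Ioc (x - y) x).filter fun n : ℕ => 1 ≤ q * n + a ∧ (e : ℤ) ∣ q * n + a).card : ℝ) := hswap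
    _ ≤ C₂ * ∑ e ∈ Icc 1 ⌊z⌋₊, ((q : ℝ) * y * ((((e.divisors.card : ℕ) : ℝ)) ^ M / e) +
          (((e.divisors.card : ℕ) : ℝ)) ^ M) := by
        refine mul_le_mul_of_nonneg_left (Finset.sum_le_sum fun e he => ?_) hC₂.le
        have h := mul_le_mul_of_nonneg_left (hcount e he) (hτ0 e)
        refine h.trans (le_of_eq ?_)
        have he0 : (0 : ℝ) < e := by exact_mod_cast (Finset.mem_Icc.mp he).1
        field_simp
    _ = C₂ * ((q : ℝ) * y * ∑ e ∈ Icc 1 ⌊z⌋₊, (((e.divisors.card : ℕ) : ℝ)) ^ M / e +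
          ∑ e ∈ Icc 1 ⌊z⌋₊, (((e.divisors.card : ℕ) : ℝ)) ^ M) := by
        rw [Finset.sum_add_distrib, Finset.mul_sum]
    _ ≤ C₂ * ((q : ℝ) * y * (C₃ * (κ₀ ^ c * Real.log x ^ c)) + C₄ * z * (κ₀ ^ c * Real.log x ^ c)) := by
        gcongr
    _ = C₂ * κ₀ ^ c * ((q : ℝ) * C₃ * ((y : ℝ) * Real.log x ^ c) + C₄ * (z * Real.log x ^ c)) := by ring
    _ ≤ C₂ * κ₀ ^ c * ((q : ℝ) * C₃ * ((y : ℝ) * Real.log x ^ c) +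
          C₄ * (Real.sqrt K * K₁ * (x : ℝ) ^ (3 / 4 : ℝ))) := by
        gcongr
    _ ≤ C₂ * κ₀ ^ c * ((q : ℝ) * C₃ + C₄ * Real.sqrt K * K₁) *
          ((y : ℝ) * Real.log x ^ c + (x : ℝ) ^ (3 / 4 : ℝ)) := by
        have h1 : 0 ≤ (y : ℝ) * Real.log x ^ c := by positivity
        have h2 : 0 ≤ (x : ℝ) ^ (3 / 4 : ℝ) := by positivity
        have h3 : 0 ≤ (q : ℝ) * C₃ := by positivity
        have h4 : 0 ≤ C₄ * Real.sqrt K * K₁ := by positivity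
        have h5 : 0 ≤ C₂ * κ₀ ^ c := by positivity
        nlinarith [mul_nonneg h3 h2, mul_nonneg h4 h1, mul_nonneg h5 (mul_nonneg h3 h2),
          mul_nonneg h5 (mul_nonneg h4 h1)]


/-! ### Two linear forms -/

/-- **Short-interval divisor products along a pair of linear forms.**  For `q₀, q₁ ≥ 1` and
`a₀, a₁ ∈ ℤ` there are `C > 0` and `c` such that for all naturals `x ≥ 2` and `y ≤ x`:
`∑_{x − y < n ≤ x} τ((q₀n + a₀)⁺) τ((q₁n + a₁)⁺) ≤ C (y (log x)^c + x^{3/4})`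
(`τ(v⁺)` = number of divisors of the natural number `max(v,0)`; from `uv ≤ u² + v²` and the
one-form bound). [folklore] -/
theorem sum_Ioc_card_divisors_mul_le {q₀ q₁ : ℤ} (hq₀ : 0 < q₀) (hq₁ : 0 < q₁) (a₀ a₁ : ℤ) :
    ∃ C : ℝ, 0 < C ∧ ∃ c : ℕ, ∀ x y : ℕ, 2 ≤ x → y ≤ x →
      ∑ n ∈ Ioc (x - y) x, ((((q₀ * n + a₀).toNat).divisors.card : ℕ) : ℝ) *
          ((((q₁ * n + a₁).toNat).divisors.card : ℕ) : ℝ) ≤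
        C * ((y : ℝ) * Real.log x ^ c + (x : ℝ) ^ (3 / 4 : ℝ)) := by
  obtain ⟨C₀, hC₀, c₀, h₀⟩ := sum_Ioc_pow_card_divisors_linear_le (s := 2) (by norm_num) hq₀ a₀
  obtain ⟨C₁, hC₁, c₁, h₁⟩ := sum_Ioc_pow_card_divisors_linear_le (s := 2) (by norm_num) hq₁ a₁
  have hlog2 : 0 < Real.log 2 := Real.log_pos one_lt_two
  obtain ⟨c, hc⟩ : ∃ c : ℕ, c = max c₀ c₁ := ⟨_, rfl⟩
  set R : ℝ := (1 / Real.log 2) ^ c with hR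
  have hR1 : 1 ≤ R := by
    refine one_le_pow₀ ?_
    rw [le_div_iff₀ hlog2, one_mul]
    have := Real.log_two_lt_d9; linarith
  refine ⟨(C₀ + C₁) * R, by positivity, c, fun x y hx hyx => ?_⟩
  have hx2 : (2 : ℝ) ≤ x := by exact_mod_cast hx
  have hL₀ : Real.log x ^ c₀ ≤ R * Real.log x ^ c := log_pow_le_of_le (by omega) hx2
  have hL₁ : Real.log x ^ c₁ ≤ R * Real.log x ^ c := log_pow_le_of_le (by omega) hx2
  have hy0 : (0 : ℝ) ≤ y := Nat.cast_nonneg y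
  have hx34 : (0 : ℝ) ≤ (x : ℝ) ^ (3 / 4 : ℝ) := by positivity
  have hxR : (x : ℝ) ^ (3 / 4 : ℝ) ≤ R * (x : ℝ) ^ (3 / 4 : ℝ) := le_mul_of_one_le_left hx34 hR1
  have hpt : ∀ n : ℕ, ((((q₀ * n + a₀).toNat).divisors.card : ℕ) : ℝ) *
      ((((q₁ * n + a₁).toNat).divisors.card : ℕ) : ℝ) ≤
      ((((q₀ * n + a₀).toNat).divisors.card : ℕ) : ℝ) ^ 2 +
        ((((q₁ * n + a₁).toNat).divisors.card : ℕ) : ℝ) ^ 2 := by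
    intro n
    nlinarith [sq_nonneg (((((q₀ * n + a₀).toNat).divisors.card : ℕ) : ℝ) -
      ((((q₁ * n + a₁).toNat).divisors.card : ℕ) : ℝ)),
      mul_nonneg (Nat.cast_nonneg (α := ℝ) ((q₀ * n + a₀).toNat).divisors.card)
        (Nat.cast_nonneg (α := ℝ) ((q₁ * n + a₁).toNat).divisors.card)]
  calc ∑ n ∈ Ioc (x - y) x, ((((q₀ * n + a₀).toNat).divisors.card : ℕ) : ℝ) *
          ((((q₁ * n + a₁).toNat).divisors.card : ℕ) : ℝ)
      ≤ ∑ n ∈ Ioc (x - y) x, (((((q₀ * n + a₀).toNat).divisors.card : ℕ) : ℝ) ^ 2 +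
          ((((q₁ * n + a₁).toNat).divisors.card : ℕ) : ℝ) ^ 2) := Finset.sum_le_sum fun n _ => hpt n
    _ = ∑ n ∈ Ioc (x - y) x, ((((q₀ * n + a₀).toNat).divisors.card : ℕ) : ℝ) ^ 2 +
          ∑ n ∈ Ioc (x - y) x, ((((q₁ * n + a₁).toNat).divisors.card : ℕ) : ℝ) ^ 2 :=
        Finset.sum_add_distrib
    _ ≤ C₀ * ((y : ℝ) * Real.log x ^ c₀ + (x : ℝ) ^ (3 / 4 : ℝ)) +
          C₁ * ((y : ℝ) * Real.log x ^ c₁ + (x : ℝ) ^ (3 / 4 : ℝ)) :=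
        add_le_add (h₀ x y hx hyx) (h₁ x y hx hyx)
    _ ≤ C₀ * ((y : ℝ) * (R * Real.log x ^ c) + R * (x : ℝ) ^ (3 / 4 : ℝ)) +
          C₁ * ((y : ℝ) * (R * Real.log x ^ c) + R * (x : ℝ) ^ (3 / 4 : ℝ)) := by
        gcongr
    _ = (C₀ + C₁) * R * ((y : ℝ) * Real.log x ^ c + (x : ℝ) ^ (3 / 4 : ℝ)) := by ring

end LinearPairShells

end Literature.NumberTheory.Sieve
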